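import Summits.CriticalPhenomena.PercolationContinuityZ3.Theorems.Transplant.Slab111SKDefs
import Mathlib.Data.List.Chain
import Mathlib.Data.List.Nodup
import HarnessLib

/-!
# Small thickness `(111)`-films, II: BIT LEMMAS for the kernel checker — masks, neighbourhoods, reachability, re-validated paths

builds on p205010 (kernel theorem, internal audit signed; external expert review pending) — NOT used in this file.  Lane `prim-bschramm`, seat
`prim-bschramm-p2` (gen 38; class C1b; memo `HOME/bschramm/P2-LATTICES.md` §136); helper file (`--supports stmt-CriticalPhenomena-4575 --as helper`).
Reading the Boolean / bitboard functions of «Slab111SKDefs» back into propositions: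
* §1 single bits, set difference, `maskBelow`, OR-folds, `maskOfList`, inclusion tests (`sdiff a b = 0`);
* §2 the neighbourhood `nbh` (a set bit has an `AdjRel`-neighbour in the argument) and **`reach_sound`** (a reachable bit is the end of an
  `AdjRel`-walk from the source inside the region);
* §3 **`pathOK_sound`** (a re-validated index list is an `AdjRel`-chain without repetitions inside its region) and `endsOK_sound`.
Nothing here mentions the film; «Slab111SKGeo» interprets indices as film vertices.
[cite: DuminilCopinSidoraviciusTassion2016, §2.3 (proof of Fact 2)]
-/

namespace Summit.CriticalPhenomena.PercolationContinuityZ3.Theorems.Transplant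

namespace Slab111.SK

/-! ## §1 Masks -/

/-- Index adjacency as a proposition. [folklore] -/
def AdjRel (i j : ℕ) : Prop := j = i + 110 ∨ j = i + 99 ∨ j = i + 91 ∨ i = j + 110 ∨ i = j + 99 ∨ i = j + 91

/-- `adjB` decides `AdjRel`. [folklore] -/
theorem adjB_iff {i j : ℕ} : adjB i j = true ↔ AdjRel i j := by
  simp only [adjB, AdjRel, Bool.or_eq_true, beq_iff_eq, or_assoc]

/-- `AdjRel` is symmetric. [folklore] -/
theorem AdjRel.symm {i j : ℕ} (h : AdjRel i j) : AdjRel j i := by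
  unfold AdjRel at *; omega

/-- Bits of a single-bit mask. [folklore] -/
@[simp] theorem testBit_bitOf (i j : ℕ) : (bitOf i).testBit j = decide (i = j) := by
  rw [bitOf, Nat.testBit_two_pow]

/-- Bits of a set difference. [folklore] -/
@[simp] theorem testBit_sdiff (m x i : ℕ) : (sdiff m x).testBit i = (m.testBit i && !x.testBit i) := by
  rw [sdiff, Nat.testBit_xor, Nat.testBit_land]
  cases m.testBit i <;> cases x.testBit i <;> rfl

/-- Bits of `maskBelow`. [folklore] -/
theorem testBit_maskBelow (p : ℕ → Bool) (n i : ℕ) : (maskBelow p n).testBit i = (decide (i < n) && p i) := by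
  induction n with
  | zero => simp [maskBelow]
  | succ n ih =>
    simp only [maskBelow]
    cases hp : p n
    · simp only [cond_false, ih]
      by_cases h : i < n
      · simp [h, Nat.lt_succ_of_lt h]
      · by_cases h' : i = n
        · subst h'; simp [hp]
        · have : ¬ i < n + 1 := by omega
          simp [h, this]
    · simp only [cond_true, Nat.testBit_lor, ih, testBit_bitOf]
      by_cases h : i < n
      · have : n ≠ i := by omega
        simp [h, Nat.lt_succ_of_lt h, this]
      · by_cases h' : i = n
        · subst h'; simp [hp]
        · have h1 : ¬ i < n + 1 := by omega
          have h2 : n ≠ i := fun e => h' e.symm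
          simp [h, h1, h2]

/-- A bit of `maskBelow p n` gives `p`. [folklore] -/
theorem of_testBit_maskBelow {p : ℕ → Bool} {n i : ℕ} (h : (maskBelow p n).testBit i = true) : i < n ∧ p i = true := by
  rw [testBit_maskBelow] at h; simpa using h

/-- Setting a bit of `maskBelow p n` from `p`. [folklore] -/
theorem testBit_maskBelow_of {p : ℕ → Bool} {n i : ℕ} (hi : i < n) (hp : p i = true) : (maskBelow p n).testBit i = true := by
  rw [testBit_maskBelow]; simp [hi, hp]

/-- Bits of an OR-accumulating fold. [folklore] -/
theorem testBit_foldl_or {α : Type} (l : List α) (g : α → ℕ) (acc : ℕ) (i : ℕ) :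
    (l.foldl (fun m x => m ||| g x) acc).testBit i = true ↔ acc.testBit i = true ∨ ∃ x ∈ l, (g x).testBit i = true := by
  induction l generalizing acc with
  | nil => simp
  | cons a l ih =>
    rw [List.foldl_cons, ih, Nat.testBit_lor, Bool.or_eq_true]
    constructor
    · rintro ((h | h) | ⟨x, hx, h⟩)
      · exact Or.inl h
      · exact Or.inr ⟨a, by simp, h⟩
      · exact Or.inr ⟨x, by simp [hx], h⟩
    · rintro (h | ⟨x, hx, h⟩)
      · exact Or.inl (Or.inl h)
      · rcases List.mem_cons.1 hx with rfl | hx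
        · exact Or.inl (Or.inr h)
        · exact Or.inr ⟨x, hx, h⟩

/-- Bits of `orFold`. [folklore] -/
theorem testBit_orFold (l : List ℕ) (g : ℕ → ℕ) (i : ℕ) : (orFold l g).testBit i = true ↔ ∃ x ∈ l, (g x).testBit i = true := by
  rw [orFold, testBit_foldl_or]; simp

/-- Bits of `maskOfList`. [folklore] -/
theorem testBit_maskOfList (l : List ℕ) (i : ℕ) : (maskOfList l).testBit i = true ↔ i ∈ l := by
  rw [maskOfList, testBit_foldl_or]
  simp only [Nat.zero_testBit, Bool.false_eq_true, testBit_bitOf, decide_eq_true_eq, false_or]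
  constructor
  · rintro ⟨x, hx, rfl⟩; exact hx
  · intro h; exact ⟨i, h, rfl⟩

/-- `maskOfList` membership, Boolean form. [folklore] -/
theorem testBit_maskOfList_eq_false {l : List ℕ} {i : ℕ} : (maskOfList l).testBit i = false ↔ i ∉ l := by
  rw [← testBit_maskOfList]; simp

/-- **Inclusion test**: `sdiff a b = 0` means every bit of `a` is a bit of `b`. [folklore] -/
theorem testBit_of_sdiff_eq_zero {a b : ℕ} (h : sdiff a b = 0) {i : ℕ} (ha : a.testBit i = true) : b.testBit i = true := by
  have := congrArg (fun n => n.testBit i) h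
  simp only [testBit_sdiff, Nat.zero_testBit, ha, Bool.true_and, Bool.not_eq_false'] at this
  exact this

/-- Inclusion test from the Boolean comparison. [folklore] -/
theorem testBit_of_sdiff_beq {a b : ℕ} (h : (sdiff a b == 0) = true) {i : ℕ} (ha : a.testBit i = true) : b.testBit i = true :=
  testBit_of_sdiff_eq_zero (by simpa using h) ha

/-- A bit of a disjointness test `a &&& b = 0`. [folklore] -/
theorem testBit_false_of_land_eq_zero {a b : ℕ} (h : (a &&& b == 0) = true) {i : ℕ} (ha : a.testBit i = true) : b.testBit i = false := by
  have h0 : a &&& b = 0 := by simpa using h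
  have := congrArg (fun n => n.testBit i) h0
  simp only [Nat.testBit_land, Nat.zero_testBit, ha, Bool.true_and] at this
  exact this

/-! ## §2 Neighbourhoods and reachability -/

/-- **A bit of the neighbourhood mask has an adjacent bit in the argument** (and lies in the universe). [folklore] -/
theorem testBit_nbh {u m j : ℕ} (h : (nbh u m).testBit j = true) : u.testBit j = true ∧ ∃ i, m.testBit i = true ∧ AdjRel i j := by
  unfold nbh at h
  rw [Nat.testBit_land, Bool.and_eq_true] at h
  refine ⟨h.2, ?_⟩
  have h1 := h.1
  simp only [Nat.testBit_lor, Bool.or_eq_true, Nat.testBit_shiftLeft, Nat.testBit_shiftRight, Bool.and_eq_true,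
    decide_eq_true_eq] at h1
  unfold AdjRel
  rcases h1 with ((((⟨h1, h2⟩ | ⟨h1, h2⟩) | ⟨h1, h2⟩) | h2) | h2) | h2
  · exact ⟨j - 110, h2, by omega⟩
  · exact ⟨j - 99, h2, by omega⟩
  · exact ⟨j - 91, h2, by omega⟩
  · exact ⟨110 + j, h2, by omega⟩
  · exact ⟨99 + j, h2, by omega⟩
  · exact ⟨91 + j, h2, by omega⟩

/-- **An index walk inside a region**: an `AdjRel`-chain `s :: l` all of whose members are bits of `R`. [folklore] -/
def IsWalkIn (R : ℕ) (s : ℕ) (l : List ℕ) : Prop := (s :: l).IsChain AdjRel ∧ ∀ x ∈ s :: l, R.testBit x = true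

/-- The end of the walk `s :: l`. [folklore] -/
def walkEnd (s : ℕ) (l : List ℕ) : ℕ := (s :: l).getLast (List.cons_ne_nil _ _)

/-- Extending a walk by an adjacent region vertex. [folklore] -/
theorem IsWalkIn.snoc {R s : ℕ} {l : List ℕ} (h : IsWalkIn R s l) {j : ℕ} (hadj : AdjRel (walkEnd s l) j) (hj : R.testBit j = true) :
    IsWalkIn R s (l ++ [j]) ∧ walkEnd s (l ++ [j]) = j := by
  refine ⟨⟨?_, ?_⟩, ?_⟩
  · have : s :: (l ++ [j]) = (s :: l) ++ [j] := rfl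
    rw [this, List.isChain_append]
    refine ⟨h.1, List.IsChain.singleton _, fun x hx y hy => ?_⟩
    rw [List.getLast?_eq_some_getLast (List.cons_ne_nil _ _), Option.mem_def, Option.some.injEq] at hx
    simp only [List.head?_cons, Option.mem_def, Option.some.injEq] at hy
    subst hx hy; exact hadj
  · intro x hx
    simp only [List.mem_cons, List.mem_append, List.not_mem_nil, or_false] at hx
    rcases hx with rfl | hx | rfl
    · exact h.2 _ (by simp)
    · exact h.2 _ (List.mem_cons_of_mem _ hx)
    · exact hj
  · show ((s :: l) ++ [j]).getLast _ = j
    simp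

/-- **SOUNDNESS OF `reachGo`**: if every bit of `cur` is the end of a walk from a bit of `src` inside `R`, the same holds for the result. [folklore] -/
theorem reachGo_sound (u R src : ℕ) :
    ∀ (f cur : ℕ), (∀ j, cur.testBit j = true → ∃ s l, src.testBit s = true ∧ IsWalkIn R s l ∧ walkEnd s l = j) →
      ∀ j, (reachGo u R f cur).testBit j = true → ∃ s l, src.testBit s = true ∧ IsWalkIn R s l ∧ walkEnd s l = j := by
  intro f
  induction f with
  | zero => intro cur hcur j hj; exact hcur j hj
  | succ f ih =>
    intro cur hcur j hj
    simp only [reachGo] at hj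
    -- the next set
    have hnxt : ∀ j, ((cur ||| nbh u cur) &&& R).testBit j = true → ∃ s l, src.testBit s = true ∧ IsWalkIn R s l ∧ walkEnd s l = j := by
      intro j hj
      rw [Nat.testBit_land, Bool.and_eq_true, Nat.testBit_lor, Bool.or_eq_true] at hj
      rcases hj with ⟨hj | hj, hR⟩
      · exact hcur j hj
      · obtain ⟨-, i, hi, hadj⟩ := testBit_nbh hj
        obtain ⟨s, l, hs, hw, he⟩ := hcur i hi
        subst he
        exact ⟨s, l ++ [j], hs, (hw.snoc hadj hR).1, (hw.snoc hadj hR).2⟩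
    cases hb : ((cur ||| nbh u cur) &&& R == cur)
    · rw [hb] at hj; exact ih _ hnxt j hj
    · rw [hb] at hj; exact hcur j hj

/-- **SOUNDNESS OF `reach`**: a reachable bit is the end of an index walk inside the region from a bit of `src ∩ region`. [folklore] -/
theorem reach_sound {u R src j : ℕ} (h : (reach u R src).testBit j = true) :
    ∃ s l, src.testBit s = true ∧ R.testBit s = true ∧ IsWalkIn R s l ∧ walkEnd s l = j := by
  unfold reach at h
  have base : ∀ j, (src &&& R).testBit j = true → ∃ s l, (src &&& R).testBit s = true ∧ IsWalkIn R s l ∧ walkEnd s l = j := by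
    intro j hj
    refine ⟨j, [], hj, ⟨List.IsChain.singleton _, fun x hx => ?_⟩, rfl⟩
    simp only [List.mem_cons, List.not_mem_nil, or_false] at hx
    subst hx
    rw [Nat.testBit_land, Bool.and_eq_true] at hj
    exact hj.2
  obtain ⟨s, l, hs, hw, he⟩ := reachGo_sound u R (src &&& R) 200 _ base j h
  rw [Nat.testBit_land, Bool.and_eq_true] at hs
  exact ⟨s, l, hs.1, hs.2, hw, he⟩

/-! ## §3 Re-validated paths -/

/-- **SOUNDNESS OF `pathOK`**: an `AdjRel`-chain without repetitions, inside `reg`, off `seen`. [folklore] -/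
theorem pathOK_sound (reg : ℕ) : ∀ (l : List ℕ) (seen : ℕ), pathOK reg l seen = true →
    l.IsChain AdjRel ∧ l.Nodup ∧ ∀ x ∈ l, reg.testBit x = true ∧ seen.testBit x = false
  | [], _, _ => ⟨List.IsChain.nil, List.nodup_nil, fun _ h => nomatch h⟩
  | [i], seen, h => by
    simp only [pathOK, Bool.and_eq_true, Bool.not_eq_true'] at h
    exact ⟨List.IsChain.singleton _, List.nodup_singleton _, fun x hx => by simp only [List.mem_singleton] at hx; subst hx; exact h⟩
  | i :: j :: rest, seen, h => by
    simp only [pathOK, Bool.and_eq_true, Bool.not_eq_true'] at h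
    obtain ⟨⟨⟨hi, hsi⟩, hij⟩, hrest⟩ := h
    obtain ⟨hch, hnd, hmem⟩ := pathOK_sound reg (j :: rest) (seen ||| bitOf i) hrest
    refine ⟨List.isChain_cons_cons.2 ⟨adjB_iff.1 hij, hch⟩, List.nodup_cons.2 ⟨fun hmi => ?_, hnd⟩, fun x hx => ?_⟩
    · have := (hmem i hmi).2
      rw [Nat.testBit_lor, testBit_bitOf] at this
      simp at this
    · rcases List.mem_cons.1 hx with rfl | hx
      · exact ⟨hi, hsi⟩
      · have := hmem x hx
        rw [Nat.testBit_lor, Bool.or_eq_false_iff] at this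
        exact ⟨this.1, this.2.1⟩

/-- Reading `endsOK`. [folklore] -/
theorem endsOK_sound {l : List ℕ} {s t : ℕ} (h : endsOK l s t = true) : l.head? = some s ∧ l.getLast? = some t := by
  simp only [endsOK, Bool.and_eq_true, beq_iff_eq] at h
  exact h

end Slab111.SK

end Summit.CriticalPhenomena.PercolationContinuityZ3.Theorems.Transplant
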